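import Literature.AnabelianGeometry.AbsoluteAnabelian.AbsTopIII.FrobeniusPictureMLF

/-!
# [AbsTopIII] Corollary 3.6 (ii), (iv) second half, and the assembled statement

Continuation of `FrobeniusPictureMLF.lean` (same sources and conventions: S. Mochizuki, *Topics in
Absolute Anabelian Geometry III*, Cor. 3.6 pp. 78–82 of the manuscript `paper:url-5493eb38cbb7`;
bib key `MochizukiAbsTopIII2015`; statement core drafted by seat abc-iut-L4-t2, re-cut and pinned
here; input data `LogFrobeniusData` / `LFVertex` / `sub n` from abc-iut-L4-t2's
`LogFrobeniusDiagram.lean`).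

This file: (ii) the telecore `𝔗_An` over the core `(𝒟_{≤5}, Anab)` of (i) — telecore edges
`φ_⋏ : Anab → 𝒳`, one for each `⋏ ∈ L† = L ∪ {□}` — and its contact structure `ℋ_An` generated by
the printed pairs `{η_{□⋎}^{±1}, η_⋏^{±1}}` (`TelecoreData`, `teleDiagram`, `ContactGen`,
`IsTelecoreAn`, `TelecoreStmt`); (iv) second half "`𝔗_An`, `ℋ_An`, `𝔖_log` are not simultaneously
compatible" (`TelecoreIncompatibleStmt`); (iii) second clause typed by its printed content
(`IotaOverGaloisStmt`: `ι_×`, `ι_{log,⋎}` lie over the identity of `ℰ`; not a field of the assembled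
structure); and `LogFrobeniusCompatible Δ τ`, the `Prop`-valued
structure with one field per printed item (i)–(v) of Cor. 3.6 (resp. Cor. 4.5, p. 107, literally
the same statement on archimedean data).  On the role of `TelecoreData` (`X₁ = 𝒳`, `id_⋎ = 𝟭` in
Cor. 3.6 / 4.5, general for the reuse by Cor. 3.7) see the module docstring of
`FrobeniusPictureMLF.lean`.  Nothing here takes a side on inter-universal Teichmüller theory.
-/

namespace Literature.AnabelianGeometry.AbsoluteAnabelian

open _root_.CategoryTheory _root_.Quiver

universe u

namespace LogFrobeniusData

open DiagramOfCategories

variable (Δ : LogFrobeniusData.{u})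

/-! ### Corollary 3.6 (ii): the telecore `𝔗_An` and its contact structure `ℋ_An` -/

/-- First-row telecore data (see the module docstring, "On `X₁`/`toNexus`"): the telecore edge
functor `φ_⋎ : Anab → 𝒳` at the first-row copies of `𝒳` (category `X₁`), the identification
`id_⋎ ∘ φ_⋎ ≅ φ_□` (whose inverse is the generator `η_{□⋎}`; the IDENTITY in Cor. 3.6, where
`X₁ = 𝒳`, `id_⋎ = 𝟭`, `φ_⋎ = φ_An`), and the isomorphism `η_⋎ : φ_⋎ ∘ κ_An ∘ (𝒳 → ℰ) ∘ id_⋎ ⥲ 𝟭`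
"arising from `η_An`" (equal to `η_An` in Cor. 3.6).  Printed instance: `⟨φ_An, unitor, η_An⟩`.
[cite: MochizukiAbsTopIII2015, Corollary 3.6 (ii) p.79] -/
structure TelecoreData where
  /-- `φ_⋎ : Anab ⥤ 𝒳` on the first row (`= φ_An` in Cor. 3.6). -/
  φ₁ : Δ.A ⥤ Δ.X₁
  /-- `id_⋎ ∘ φ_⋎ ≅ φ_□` (the identity in Cor. 3.6). -/
  e : φ₁ ⋙ Δ.toNexus ≅ Δ.φ
  /-- `η_⋎` on the first row (`= η_An` in Cor. 3.6). -/
  η₁ : ((Δ.toNexus ⋙ Δ.XtoE) ⋙ Δ.κ) ⋙ φ₁ ≅ 𝟭 Δ.X₁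

/-- The shape of a telecore diagram over the core `(𝒟_{≤5}, Anab)`: observation edge `κ_An`,
telecore edges `J`. [cite: MochizukiAbsTopIII2015, Corollary 3.6 (ii) p.79] -/
def teleShape (J : SubVertex {a : LFVertex | a.row ≤ 4} → Type u) :
    ExtShape.{u} (SubVertex {a : LFVertex | a.row ≤ 4}) :=
  ⟨coreI5.{u}, J⟩

/-- The telecore diagram `𝒟_An` (restricted to `𝒟_{≤5}`): `𝒟_{≤4}`, the core vertex `Anab` with
`κ_An`, and telecore edges `J` carrying functors `telMap`. This is, definitionally, the diagram on
which the family `𝒥` of a `Telecore (coreObs5 …)` lives. [cite: MochizukiAbsTopIII2015, Corollary 3.6 (ii) p.79] -/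
def teleDiagram (J : SubVertex {a : LFVertex | a.row ≤ 4} → Type u)
    (telMap : ∀ {a}, J a → (Δ.A ⥤ (Δ.sub 4).obj a)) :
    DiagramOfCategories (teleShape J).Vertex :=
  (Δ.sub 4).extend (X := teleShape J) ⟨Δ.A, Δ.coreExt5.obsMap, telMap⟩

section TelePaths

variable (J : SubVertex {a : LFVertex | a.row ≤ 4} → Type u)

/-- The first-row vertex `⋎ = n` of the telecore diagram. [cite: MochizukiAbsTopIII2015, Corollary 3.6 (ii) p.79] -/
def tvRow1 (n : ℤ) : (teleShape J).Vertex :=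
  (teleShape J).base (vx 4 (.row1 n) (by simp [LFVertex.row]))

/-- The nexus `□` of the telecore diagram. [cite: MochizukiAbsTopIII2015, Corollary 3.6 (ii) p.79] -/
def tvNexus : (teleShape J).Vertex := (teleShape J).base (vx 4 .nexus (by decide))

/-- The vertex `𝒩` of the telecore diagram. [cite: MochizukiAbsTopIII2015, Corollary 3.6 (ii) p.79] -/
def tvThird : (teleShape J).Vertex := (teleShape J).base (vx 4 .third (by decide))

/-- The vertex `ℰ` (row 4) of the telecore diagram. [cite: MochizukiAbsTopIII2015, Corollary 3.6 (ii) p.79] -/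
def tvFourth : (teleShape J).Vertex := (teleShape J).base (vx 4 .fourth (by decide))

/-- The core vertex `Anab` of the telecore diagram. [cite: MochizukiAbsTopIII2015, Corollary 3.6 (ii) p.79] -/
def tvObs : (teleShape J).Vertex := (teleShape J).obs

variable {J}

/-- A telecore edge `φ_⋏ : Anab → ⋏` as an edge of the telecore diagram. [folklore] -/
def ePhi {a : SubVertex {a : LFVertex | a.row ≤ 4}} (j : J a) : (tvObs J ⟶ (teleShape J).base a) := j

/-- `[φ_□]`, the path of length one along the telecore edge at the nexus.
[cite: MochizukiAbsTopIII2015, Corollary 3.6 (ii) p.79] -/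
def pathPhiNexus (j : J (vx 4 .nexus (by decide))) : Path (tvObs J) (tvNexus J) :=
  (Path.nil : Path (tvObs J) (tvObs J)).cons (ePhi j)

/-- `[id_⋎] ∘ [φ_⋎]`: from `Anab` to the first-row copy `⋎ = n`, then `id_⋎` to `□`.
[cite: MochizukiAbsTopIII2015, Corollary 3.6 (ii) p.80] -/
def pathPhiId (n : ℤ) (j : J (vx 4 (.row1 n) (by simp [LFVertex.row]))) :
    Path (tvObs J) (tvNexus J) :=
  ((Path.nil : Path (tvObs J) (tvObs J)).cons (ePhi j)).cons
    (show tvRow1 J n ⟶ tvNexus J from LFVertex.idEdge n)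

/-- `[β¹_□]`: from `□` "descend [via `λ^×`] to the core vertex `Anab` and return to `□` via the
telecore edge `φ_□`" (length 4). [cite: MochizukiAbsTopIII2015, Corollary 3.6 (ii) p.79] -/
def pathBetaNexus (j : J (vx 4 .nexus (by decide))) : Path (tvNexus J) (tvNexus J) :=
  (((((Path.nil : Path (tvNexus J) (tvNexus J)).cons
    (show tvNexus J ⟶ tvThird J from LFVertex.lamTimesEdge)).cons
    (show tvThird J ⟶ tvFourth J from LFVertex.edge34)).cons
    (show tvFourth J ⟶ tvObs J from (PUnit.unit : coreI5.{u} (vx 4 .fourth (by decide))))).cons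
    (ePhi j))

/-- `[β¹_⋎]` for a first-row vertex `⋎ = n`: `id_⋎`, `λ^×`, `𝒩 → ℰ`, `κ_An`, then back via `φ_⋎`
(length 5). [cite: MochizukiAbsTopIII2015, Corollary 3.6 (ii) p.79] -/
def pathBetaRow1 (n : ℤ) (j : J (vx 4 (.row1 n) (by simp [LFVertex.row]))) :
    Path (tvRow1 J n) (tvRow1 J n) :=
  ((((((Path.nil : Path (tvRow1 J n) (tvRow1 J n)).cons
    (show tvRow1 J n ⟶ tvNexus J from LFVertex.idEdge n)).cons
    (show tvNexus J ⟶ tvThird J from LFVertex.lamTimesEdge)).cons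
    (show tvThird J ⟶ tvFourth J from LFVertex.edge34)).cons
    (show tvFourth J ⟶ tvObs J from (PUnit.unit : coreI5.{u} (vx 4 .fourth (by decide))))).cons
    (ePhi j))

/-- The printed GENERATORS of the contact structure `ℋ_An`: the pairs of paths indexing
`{η_{□⋎}, η_{□⋎}⁻¹, η_⋏, η_⋏⁻¹}_{⋎ ∈ L, ⋏ ∈ L†}` — `η_{□⋎} : [φ_□] → [id_⋎]∘[φ_⋎]`,
`η_⋏ : [β¹_⋏] → [β⁰_⋏]` (`β⁰_⋏` the length-zero path) — and their reverses.
[cite: MochizukiAbsTopIII2015, Corollary 3.6 (ii) pp.79–80] -/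
inductive ContactGen : ∀ ⦃a b : (teleShape J).Vertex⦄, Path a b → Path a b → Prop
  | etaSq (n : ℤ) (j : J (vx 4 .nexus (by decide))) (jn : J (vx 4 (.row1 n) (by simp [LFVertex.row]))) :
      ContactGen (pathPhiNexus j) (pathPhiId n jn)
  | etaSqInv (n : ℤ) (j : J (vx 4 .nexus (by decide))) (jn : J (vx 4 (.row1 n) (by simp [LFVertex.row]))) :
      ContactGen (pathPhiId n jn) (pathPhiNexus j)
  | etaNexus (j : J (vx 4 .nexus (by decide))) : ContactGen (pathBetaNexus j) Path.nil
  | etaNexusInv (j : J (vx 4 .nexus (by decide))) : ContactGen Path.nil (pathBetaNexus j)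
  | etaRow1 (n : ℤ) (jn : J (vx 4 (.row1 n) (by simp [LFVertex.row]))) :
      ContactGen (pathBetaRow1 n jn) Path.nil
  | etaRow1Inv (n : ℤ) (jn : J (vx 4 (.row1 n) (by simp [LFVertex.row]))) :
      ContactGen Path.nil (pathBetaRow1 n jn)

end TelePaths

/-- The printed SHAPE of the telecore `𝔗_An` over the core `(𝒟_{≤5}, Anab)`: exactly one telecore
edge `φ_⋏` to each vertex `⋏ ∈ L† = L ∪ {□}` of the first two rows and none elsewhere, carrying
`φ_An` at `□` and `φ_⋎` (`TelecoreData.φ₁`) on the first row.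
[cite: MochizukiAbsTopIII2015, Corollary 3.6 (ii) p.79] -/
structure IsTelecoreAn (τ : Δ.TelecoreData) {H : Δ.core5Diagram.HomotopyFamily}
    {hH : ∀ ⦃a b : coreShape5.{u}.Vertex⦄ ⦃p q : Path a b⦄, H.E p q → b = coreShape5.{u}.obs}
    {hc : (Δ.coreObs5 H hH).IsCore} (T : (Δ.sub 4).Telecore (Δ.coreObs5 H hH) hc) : Prop where
  edges_iff : ∀ a, Nonempty (T.J a) ↔ a.1.row ≤ 2
  edges_subsingleton : ∀ a, Subsingleton (T.J a)
  telMap_nexus : ∀ (h : LFVertex.nexus ∈ {a : LFVertex | a.row ≤ 4}) (j : T.J ⟨.nexus, h⟩),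
    T.telMap j = Δ.φ
  telMap_row1 : ∀ (n : ℤ) (h : LFVertex.row1 n ∈ {a : LFVertex | a.row ≤ 4}) (j : T.J ⟨.row1 n, h⟩),
    T.telMap j = τ.φ₁

/-- **Cor. 3.6 (ii)** (telecore and contact structure): "`φ_An` gives rise to a telecore structure
`𝔗_An` on `𝒟_{≤4}` … by appending to `𝒟_{≤5}` telecore edges … from the core `Anab` to the various
copies of `𝒳` in `𝒟_{≤2}` given by copies of `φ_An`, which we denote by `φ_⋏`, for `⋏ ∈ L†`", and
"the collection of natural transformations `{η_{□⋎}, η_{□⋎}⁻¹, η_⋏, η_⋏⁻¹}_{⋎ ∈ L, ⋏ ∈ L†}` — where we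
write `η_{□⋎}` for the identity natural transformation from the arrow `φ_□ : Anab → 𝒳` to the
composite arrow `id_⋎ ∘ φ_⋎ : Anab → 𝒳` and `η_⋏ : (𝒟_An)_{[β¹_⋏]} ⥲ (𝒟_An)_{[β⁰_⋏]}` for the
isomorphism arising from `η_An` — generate a contact structure `ℋ_An` on the telecore `𝔗_An`".
Typed: over SOME core structure on `(𝒟_{≤5}, Anab)` (cf. `CoreStmt5`) there is a telecore of the
printed shape (`IsTelecoreAn`) and a family `ℋ_An` on its diagram, compatible with the telecore
family (`IsContactStructure`), generated by `ContactGen`, whose homotopies on the generators are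
the printed ones: `η_{□⋎} = (TelecoreData.e)⁻¹` (the identity in Cor. 3.6), `η_□ = η_An`,
`η_⋎ = TelecoreData.η₁` (components compared through `eqToHom` of object equalities).  The
equivalence clause of (ii) (`φ_An` an equivalence with quasi-inverse `π_An = κ_An ∘ (𝒳 → ℰ)`,
`η_An : φ_An ∘ π_An ⥲ id_𝒳`) is DATA of `LogFrobeniusData` (`φ_equiv`, `η`).
[cite: MochizukiAbsTopIII2015, Corollary 3.6 (ii) pp.79–80] -/
def TelecoreStmt (τ : Δ.TelecoreData) : Prop :=
  ∃ (H : Δ.core5Diagram.HomotopyFamily)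
    (hH : ∀ ⦃a b : coreShape5.{u}.Vertex⦄ ⦃p q : Path a b⦄, H.E p q → b = coreShape5.{u}.obs)
    (hc : (Δ.coreObs5 H hH).IsCore) (T : (Δ.sub 4).Telecore (Δ.coreObs5 H hH) hc),
    Δ.IsTelecoreAn τ T ∧
    ∃ Hc : (Δ.teleDiagram T.J T.telMap).HomotopyFamily,
      Telecore.IsContactStructure _ T Hc ∧ HomotopyFamily.IsGeneratedBy _ Hc ContactGen ∧
      -- `η_{□⋎}` : components `(e⁻¹)_a : φ_□(a) ⟶ id_⋎(φ_⋎(a))`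
      (∀ (n : ℤ) (j : T.J (vx 4 .nexus (by decide)))
          (jn : T.J (vx 4 (.row1 n) (by simp [LFVertex.row])))
          (h : Hc.E (pathPhiNexus j) (pathPhiId n jn)) (a : Δ.A)
          (e₁ : ((Δ.teleDiagram T.J T.telMap).pathFunctor (pathPhiNexus j)).obj a = Δ.φ.obj a)
          (e₂ : ((Δ.teleDiagram T.J T.telMap).pathFunctor (pathPhiId n jn)).obj a =
            Δ.toNexus.obj (τ.φ₁.obj a)),
          (Hc.η h).app a = eqToHom e₁ ≫ τ.e.inv.app a ≫ eqToHom e₂.symm) ∧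
      -- `η_□ = η_An` : components `φ_An(κ_An(E(x))) ⟶ x`
      (∀ (j : T.J (vx 4 .nexus (by decide))) (h : Hc.E (pathBetaNexus j) Path.nil) (x : Δ.X)
          (e₁ : ((Δ.teleDiagram T.J T.telMap).pathFunctor (pathBetaNexus j)).obj x =
            Δ.φ.obj (Δ.κ.obj (Δ.XtoE.obj x)))
          (e₂ : ((Δ.teleDiagram T.J T.telMap).pathFunctor
            (Path.nil : Path (tvNexus T.J) (tvNexus T.J))).obj x = x),
          (Hc.η h).app x = eqToHom e₁ ≫ Δ.η.hom.app x ≫ eqToHom e₂.symm) ∧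
      -- `η_⋎ = η₁` on the first row
      (∀ (n : ℤ) (jn : T.J (vx 4 (.row1 n) (by simp [LFVertex.row])))
          (h : Hc.E (pathBetaRow1 n jn) Path.nil) (x : Δ.X₁)
          (e₁ : ((Δ.teleDiagram T.J T.telMap).pathFunctor (pathBetaRow1 n jn)).obj x =
            τ.φ₁.obj (Δ.κ.obj (Δ.XtoE.obj (Δ.toNexus.obj x))))
          (e₂ : ((Δ.teleDiagram T.J T.telMap).pathFunctor
            (Path.nil : Path (tvRow1 T.J n) (tvRow1 T.J n))).obj x = x),
          (Hc.η h).app x = eqToHom e₁ ≫ τ.η₁.hom.app x ≫ eqToHom e₂.symm)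


/-! ### Corollary 3.6 (iv), second half: `𝔗_An`, `ℋ_An`, `𝔖_log` not simultaneously compatible -/

section TeleLogPaths

variable (J : SubVertex {a : LFVertex | a.row ≤ 4} → Type u)

/-- `[λ^×] ∘ [id_⋎] ∘ [log]` from `⋎+1`, as a path of a telecore diagram (rows `≤ 4`).
[cite: MochizukiAbsTopIII2015, Corollary 3.6 (iv) p.82] -/
def tLogPairLeft (n : ℤ) : Path (tvRow1 J (n + 1)) (tvThird J) :=
  (((Path.nil : Path (tvRow1 J (n + 1)) (tvRow1 J (n + 1))).cons
    (show tvRow1 J (n + 1) ⟶ tvRow1 J n from LFVertex.logEdge n)).cons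
    (show tvRow1 J n ⟶ tvNexus J from LFVertex.idEdge n)).cons
    (show tvNexus J ⟶ tvThird J from LFVertex.lamTimesEdge)

/-- `[λ^{×pf}] ∘ [id_{⋎+1}]` from `⋎+1`, as a path of a telecore diagram.
[cite: MochizukiAbsTopIII2015, Corollary 3.6 (iv) p.82] -/
def tLogPairRight (n : ℤ) : Path (tvRow1 J (n + 1)) (tvThird J) :=
  ((Path.nil : Path (tvRow1 J (n + 1)) (tvRow1 J (n + 1))).cons
    (show tvRow1 J (n + 1) ⟶ tvNexus J from LFVertex.idEdge (n + 1))).cons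
    (show tvNexus J ⟶ tvThird J from LFVertex.lamPfEdge)

/-- `[λ^×]` as a path of a telecore diagram. [cite: MochizukiAbsTopIII2015, Corollary 3.6 (iv) p.82] -/
def tTimesPath : Path (tvNexus J) (tvThird J) :=
  (Path.nil : Path (tvNexus J) (tvNexus J)).cons (show tvNexus J ⟶ tvThird J from LFVertex.lamTimesEdge)

/-- `[λ^{×pf}]` as a path of a telecore diagram. [cite: MochizukiAbsTopIII2015, Corollary 3.6 (iv) p.82] -/
def tPfPath : Path (tvNexus J) (tvThird J) :=
  (Path.nil : Path (tvNexus J) (tvNexus J)).cons (show tvNexus J ⟶ tvThird J from LFVertex.lamPfEdge)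

variable {J}

/-- `LogPinned` for a family on a telecore diagram: it contains the `𝔖_log` generators (type (1) for
every `⋎`, type (2)) with homotopies `ι_{log,⋎}`, `ι_×`. [cite: MochizukiAbsTopIII2015, Corollary 3.6 (iv) p.82] -/
def TeleLogPinned {telMap : ∀ {a}, J a → (Δ.A ⥤ (Δ.sub 4).obj a)}
    (K : (Δ.teleDiagram J telMap).HomotopyFamily) : Prop :=
  (match Δ.ιtimes with
    | .inl ι => ∃ h : K.E (tTimesPath J) (tPfPath J),
        ∀ (x : Δ.X) (e₁ : ((Δ.teleDiagram J telMap).pathFunctor (tTimesPath J)).obj x = Δ.lamTimes.obj x)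
          (e₂ : ((Δ.teleDiagram J telMap).pathFunctor (tPfPath J)).obj x = Δ.lamPf.obj x),
          (K.η h).app x = eqToHom e₁ ≫ ι.app x ≫ eqToHom e₂.symm
    | .inr ι => ∃ h : K.E (tPfPath J) (tTimesPath J),
        ∀ (x : Δ.X) (e₁ : ((Δ.teleDiagram J telMap).pathFunctor (tPfPath J)).obj x = Δ.lamPf.obj x)
          (e₂ : ((Δ.teleDiagram J telMap).pathFunctor (tTimesPath J)).obj x = Δ.lamTimes.obj x),
          (K.η h).app x = eqToHom e₁ ≫ ι.app x ≫ eqToHom e₂.symm) ∧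
  ∀ n : ℤ, ∃ h : K.E (tLogPairLeft J n) (tLogPairRight J n),
    ∀ (x : Δ.X₁)
      (e₁ : ((Δ.teleDiagram J telMap).pathFunctor (tLogPairLeft J n)).obj x =
        Δ.lamTimes.obj (Δ.toNexus.obj (Δ.log.obj x)))
      (e₂ : ((Δ.teleDiagram J telMap).pathFunctor (tLogPairRight J n)).obj x =
        Δ.lamPf.obj (Δ.toNexus.obj x)),
      (K.η h).app x = eqToHom e₁ ≫ Δ.ιlog.app x ≫ eqToHom e₂.symm

end TeleLogPaths

/-- **Cor. 3.6 (iv), second incompatibility**: "the telecore structure `𝔗_An` of (ii), the contact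
structure `ℋ_An` of (ii), and the observable `𝔖_log` of (iii) are not simultaneously compatible [but
cf. Remark 3.7.3, (ii)]."  Typed (implies the printed clause, whose "compatible" = one family of
homotopies containing all three, Def. 3.5 (ii)): for every core structure on `(𝒟_{≤5}, Anab)` and
every telecore of the printed shape over it, NO family of homotopies on the telecore diagram
contains the boundary pairs of the telecore family, the contact generators `ContactGen` (both
orientations) and the `𝔖_log` generators with `ι_{log,⋎}`, `ι_×` (proof, p. 82: the homotopies
`[φ_□] ⇝ [id_{⋎+1}]∘[φ_{⋎+1}]` and `[φ_□] ⇝ [id_⋎]∘[log]∘[φ_{⋎+1}]` then contradict Lemma 3.4).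
[cite: MochizukiAbsTopIII2015, Corollary 3.6 (iv) pp.80–82] -/
def TelecoreIncompatibleStmt (τ : Δ.TelecoreData) : Prop :=
  ∀ (H : Δ.core5Diagram.HomotopyFamily)
    (hH : ∀ ⦃a b : coreShape5.{u}.Vertex⦄ ⦃p q : Path a b⦄, H.E p q → b = coreShape5.{u}.obs)
    (hc : (Δ.coreObs5 H hH).IsCore) (T : (Δ.sub 4).Telecore (Δ.coreObs5 H hH) hc),
    Δ.IsTelecoreAn τ T →
    ¬ ∃ K : (Δ.teleDiagram T.J T.telMap).HomotopyFamily,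
        (∀ ⦃a b : (teleShape T.J).Vertex⦄ (p q : Path a b), T.Jfam.E p q → K.E p q) ∧
        (∀ ⦃a b : (teleShape T.J).Vertex⦄ (p q : Path a b), ContactGen p q → K.E p q) ∧
        Δ.TeleLogPinned K

/-! ### Corollary 3.6 (iii), second clause: the homotopies of `𝔖_log` lie over `ℰ` -/

/-- **Cor. 3.6 (iii), second clause** — "[the family of homotopies of `𝔖_log`] is compatible with the
families of homotopies that constitute the core and telecore structures of (i), (ii)" — typed by
its printed CONTENT (proof, p. 81: "it is immediate from the definitions — i.e., in essence, because
the various Galois groups that appear remain 'undisturbed' by the various manipulations involving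
arithmetic data that arise from '`ι_{log,⋎}`', '`ι_×`' — that this family of homotopies is compatible
with the families of homotopies that constitute the core and telecore structures"): the natural
transformations `ι_×` and `ι_{log,⋎}` LIE OVER THE IDENTITY OF `ℰ`, i.e. after applying `𝒩 → ℰ` the
component of `ι_×` at `x` is the identity of the Galois group `(𝒳 → ℰ)(x)` (through
`λ^× ⋙ (𝒩 → ℰ) = (𝒳 → ℰ) = λ^{×pf} ⋙ (𝒩 → ℰ)`), and the component of `ι_{log,⋎}` at `x` is the
isomorphism of Galois groups induced by `log ≅ 𝟭`.  (The literal Def. 3.5 (ii) "compatible" — one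
family on a common diagram containing `𝔖_log`, the cores and the telecore — needs transport of
families along the graph embeddings `𝒟_{≤3} ↪ 𝒟_{≤4} ↪ 𝒟_An` and is not typed; a common family forces
exactly these two identities, by saturation: `([λ^×]∘γ, [λ^{×pf}]∘γ)` post-composed with `𝒩 → ℰ` is
a pair of the core `ℰ`.)  NOT a field of `LogFrobeniusCompatible` (kept as drafted for its consumers).
[cite: MochizukiAbsTopIII2015, Corollary 3.6 (iii) p.81] -/
def IotaOverGaloisStmt : Prop :=
  (match Δ.ιtimes with
    | .inl ι => ∀ x : Δ.X, Δ.NtoE.map (ι.app x) =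
        eqToHom ((Functor.congr_obj Δ.lamTimes_NtoE x).trans (Functor.congr_obj Δ.lamPf_NtoE x).symm)
    | .inr ι => ∀ x : Δ.X, Δ.NtoE.map (ι.app x) =
        eqToHom ((Functor.congr_obj Δ.lamPf_NtoE x).trans (Functor.congr_obj Δ.lamTimes_NtoE x).symm)) ∧
  ∀ x : Δ.X₁, Δ.NtoE.map (Δ.ιlog.app x) =
    eqToHom (Functor.congr_obj Δ.lamTimes_NtoE (Δ.toNexus.obj (Δ.log.obj x))) ≫
      Δ.XtoE.map (Δ.toNexus.map (Δ.logIsoId.hom.app x)) ≫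
        eqToHom (Functor.congr_obj Δ.lamPf_NtoE (Δ.toNexus.obj x)).symm

/-! ### Corollary 3.6 assembled -/

/-- **Corollary 3.6 (MLF-Galois-theoretic mono-anabelian log-Frobenius compatibility)** — resp.
**Corollary 4.5** (Aut-holomorphic version, p. 107, literally the same statement on the archimedean
data with `ι_×` reversed) — as a `Prop`-valued structure on the abstract input data `Δ` and the
first-row telecore data `τ` (`= ⟨φ_An, unitor, η_An⟩` in print), one field per printed item:
(i) `ℰ`, `Anab`, `ℰ` form cores of `𝒟_{≤3}`, `𝒟_{≤4}`, `𝒟_{≤5}`; (ii) the telecore `𝔗_An` with its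
contact structure `ℋ_An` generated by `{η_{□⋎}^{±1}, η_⋏^{±1}}`; (iii) the observable `𝔖_log` generated
by `ι_{log,⋎}`, `ι_×`; (iv) the two incompatibilities; (v) `□` is a nexus, `𝒟` is totally `□`-rigid,
and `ℤ` acts by nexus-classes of self-equivalences.  The MLF-Galois instance (`𝒳 = 𝒞^{MLF-sB}_T`,
`T ∈ {TM, TF}`, `ℰ = 𝒯𝒢^{sB}`, `𝒩 = 𝒞^{MLF-sB}_{TS}`, `Anab`) is the printed assertion; it is to be
supplied by the Def. 3.1 / Cor. 1.10 model files and is NOT asserted here.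
[cite: MochizukiAbsTopIII2015, Corollary 3.6 (i)–(v) pp.78–80] -/
structure LogFrobeniusCompatible (τ : Δ.TelecoreData) : Prop where
  /-- (i), `n = 4`: `ℰ` forms a core of `𝒟_{≤3}`. -/
  core4 : Δ.CoreStmt4
  /-- (i), `n = 5`: `Anab` forms a core of `𝒟_{≤4}`. -/
  core5 : Δ.CoreStmt5
  /-- (i), `n = 6`: `ℰ` forms a core of `𝒟_{≤5}`. -/
  core6 : Δ.CoreStmt6
  /-- (ii): the telecore `𝔗_An` over the core `Anab` and its contact structure `ℋ_An`. -/
  telecore : Δ.TelecoreStmt τ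
  /-- (iii): the observable `𝔖_log`. -/
  observable_log : Δ.ObservableLogStmt
  /-- (iv): no core on `𝒟_{≤1}` compatible with `𝔖_log`. -/
  incompatible_core : Δ.IncompatibleStmt
  /-- (iv): `𝔗_An`, `ℋ_An`, `𝔖_log` are not simultaneously compatible. -/
  incompatible_telecore : Δ.TelecoreIncompatibleStmt τ
  /-- (v): `□` is a nexus and `𝒟` is totally `□`-rigid. -/
  nexus_rigid : Δ.NexusRigidStmt
  /-- (v): the `ℤ`-action by nexus-classes of self-equivalences. -/
  shift : Δ.ShiftStmt

end LogFrobeniusData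

end Literature.AnabelianGeometry.AbsoluteAnabelian
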